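import Mathlib
import HarnessLib

/-!
# Crux `NoZenoR` (stmt-ResolutionOfSingularities-19943) = `NoZeno` (stmt-16483), line `sandwich-cluster`:
# G-layer, LEMMA L — the vocabulary-free LATTICE HALF (least vanishing cycle; annihilator = X-complete ideal)

OURS (cell res-hironaka, chain W4.4; CHAIN v6 §2 OPEN ROW «G1 LEMMA L», seat res-D-pv-045 AS
res-L0-w44-stub-8; mathematics of record: planner res-L0-w44-plan-1 CRUX-PLAN v4.0.2 §1.1 (c)–(d) and
§1.3 (hull step), = res-L0-w44-idea-1 THEOREM Q-rat Lemma A). Nothing of [claim: Hironaka2017] is used.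

LEMMA L says: for a two-dimensional normal local domain `T`, a desingularisation `X → Spec T` with
exceptional components `E_i` (`i : ι`, finite) and a torsion-free coherent `F` on `X`, the annihilator
`ann_T H¹(X, F)` is the X-complete ideal `I_{Z₀} = {x : Z_x ≥ Z₀}` of a unique least «vanishing cycle»
`Z₀`. Its proof has a sheaf half — (a) finite length and `H² = 0`, (b) the formula (★)
`x · H¹(X, F) = im [H¹(F(−Z_x)) → H¹(F)]` (affineness of the non-exceptional part of `div x`) and the
Mayer–Vietoris estimate `im ρ_{Z ∧ Z'} ⊆ im ρ_Z + im ρ_{Z'}` — and a lattice half (c)–(d), which is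
what this file proves, ABSTRACTLY, so that it serves either rendering of the G-layer (tree scheme
vocabulary or bespoke sky-Čech; lead res-L0-w44-lead-1 KERNEL-L0 §16):

* cycles are `Z : ι → ℕ` with the pointwise order (`ι` finite: the exceptional components, or the
  essential prime divisors of `T`);
* the cohomology group is an abstract `T`-module `H`, and `Z ↦ N Z ≤ H` («`im ρ_Z`») is any ANTITONE,
  MEET-SUBADDITIVE (`N (Z ⊓ Z') ≤ N Z ⊔ N Z'`) family with SOME vanishing member;
* the divisor map is any `cyc : T → ι → ℕ` («`x ↦ Z_x`», used at `x ≠ 0` only) with (★)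
  `range (x • ·) = N (Z_x)`.

Results: `exists_isLeast_of_infClosed_upperSet` / `exists_least_eq_bot` (existence of the least
vanishing cycle `Z₀`, with `{Z : N Z = ⊥} = {Z : Z₀ ≤ Z}`; uniqueness `least_eq_bot_unique`);
`mem_annihilator_iff_le_cyc` (LEMMA L (d): `ann_T H = I_{Z₀}`); and the hull step of CRUX-PLAN §1.3
(`setOf_cycleIdeal_antitone`, `iInter_setOf_le_cyc_eq_finsetSup`, `iInter_setOf_le_cyc_eq_ciSup`:
`⋂_j I_{Z_j} = I_{sup_j Z_j}` for finite, resp. bounded, families — «only finitely many `Z(L)` occur,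
so `ca(T) = ⋂_L I_{Z(L)} = I_Z`»). All statements are elementary order theory / linear algebra;
no scheme, sheaf or valuation object is introduced here.

References: J. Lipman, *Rational singularities…*, Publ. Math. IHÉS 36 (1969), §12 and §18 (complete
ideals `I_Z` attached to anti-nef cycles) [`Lipman1969`]; CRUX-PLAN v4.0.2 §1.1 [this work].
-/

-- single-problem summit: the doubled namespace component `ResolutionOfSingularities` is forced
set_option linter.dupNamespace false

namespace Summit.ResolutionOfSingularities.ResolutionOfSingularities.Theorems.NoZeno.SandwichCluster.CycleLattice

/-! ## (c) The least element of an up-closed, meet-closed, non-empty family of cycles -/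

/-- **Least cycle of an up-closed meet-closed family.** In the lattice of cycles `ι → ℕ` (`ι` finite),
a non-empty family `𝒵` which is closed upwards and under binary meets has a least element `Z₀`, and
then `𝒵 = {Z | Z₀ ≤ Z}`. (Proof: coordinatewise minima are attained by members `Z⁽ⁱ⁾ ∈ 𝒵`; their finite
meet lies in `𝒵` and is below every member.) This is step (c) of LEMMA L, CRUX-PLAN v4.0.2 §1.1.
[this work] -/
theorem exists_isLeast_of_infClosed_upperSet {ι : Type*} [Finite ι] (𝒵 : Set (ι → ℕ))
    (hne : 𝒵.Nonempty) (hup : ∀ ⦃Z Z' : ι → ℕ⦄, Z ∈ 𝒵 → Z ≤ Z' → Z' ∈ 𝒵)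
    (hinf : ∀ ⦃Z Z' : ι → ℕ⦄, Z ∈ 𝒵 → Z' ∈ 𝒵 → Z ⊓ Z' ∈ 𝒵) :
    ∃ Z₀ ∈ 𝒵, ∀ Z, Z ∈ 𝒵 ↔ Z₀ ≤ Z := by
  classical
  haveI : Fintype ι := Fintype.ofFinite ι
  rcases isEmpty_or_nonempty ι with hι | hι
  · obtain ⟨Z₀, hZ₀⟩ := hne
    refine ⟨Z₀, hZ₀, fun Z => ⟨fun _ => fun i => isEmptyElim i, fun _ => ?_⟩⟩
    have : Z = Z₀ := funext fun i => isEmptyElim i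
    exact this ▸ hZ₀
  -- coordinatewise minima, each attained by a member of `𝒵`
  have hcoord : ∀ i : ι, ∃ Z ∈ 𝒵, Z i = sInf {n : ℕ | ∃ Z ∈ 𝒵, Z i = n} := by
    intro i
    have hS : ({n : ℕ | ∃ Z ∈ 𝒵, Z i = n} : Set ℕ).Nonempty := by
      obtain ⟨Z, hZ⟩ := hne
      exact ⟨Z i, Z, hZ, rfl⟩
    obtain ⟨Z, hZ, hZi⟩ := Nat.sInf_mem hS
    exact ⟨Z, hZ, hZi⟩
  choose W hW𝒵 hWi using hcoord
  -- their finite meet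
  refine ⟨Finset.univ.inf' Finset.univ_nonempty W, ?_, fun Z => ⟨fun hZ => ?_, fun hle => ?_⟩⟩
  · exact Finset.inf'_mem 𝒵 (fun Z hZ Z' hZ' => hinf hZ hZ') Finset.univ Finset.univ_nonempty W
      fun i _ => hW𝒵 i
  · intro i
    rw [Finset.inf'_apply]
    calc Finset.univ.inf' Finset.univ_nonempty (fun j => W j i)
        ≤ W i i := Finset.inf'_le _ (Finset.mem_univ i)
      _ = sInf {n : ℕ | ∃ Z ∈ 𝒵, Z i = n} := hWi i
      _ ≤ Z i := Nat.sInf_le ⟨Z, hZ, rfl⟩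
  · exact hup (Finset.inf'_mem 𝒵 (fun Z hZ Z' hZ' => hinf hZ hZ') Finset.univ Finset.univ_nonempty W
      fun i _ => hW𝒵 i) hle

/-- **The least vanishing cycle.** For an antitone, meet-subadditive family `Z ↦ N Z` in a
`⊔`-semilattice with `⊥` (e.g. submodules `im ρ_Z` of `H¹(X, F)`), indexed by cycles `ι → ℕ` with `ι`
finite, and vanishing somewhere, there is a cycle `Z₀` with `N Z = ⊥ ↔ Z₀ ≤ Z`. (LEMMA L (c): the
vanishing locus is up-closed by antitonicity and meet-closed by `N (Z ⊓ Z') ≤ N Z ⊔ N Z' = ⊥`.)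
[this work] -/
theorem exists_least_eq_bot {ι α : Type*} [Finite ι] [SemilatticeSup α] [OrderBot α]
    (N : (ι → ℕ) → α) (anti : Antitone N) (hmeet : ∀ Z Z', N (Z ⊓ Z') ≤ N Z ⊔ N Z')
    (hvan : ∃ Z, N Z = ⊥) : ∃ Z₀, ∀ Z, N Z = ⊥ ↔ Z₀ ≤ Z := by
  obtain ⟨Z₀, -, hZ₀⟩ := exists_isLeast_of_infClosed_upperSet {Z | N Z = ⊥} hvan
    (fun Z Z' hZ hle => le_bot_iff.mp ((anti hle).trans (le_of_eq hZ)))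
    (fun Z Z' hZ hZ' => le_bot_iff.mp ((hmeet Z Z').trans (by rw [hZ, hZ', sup_bot_eq])))
  exact ⟨Z₀, hZ₀⟩

/-- The least vanishing cycle is unique. [folklore] -/
theorem least_eq_bot_unique {ι α : Type*} (N : (ι → ℕ) → α) [Bot α] {Z₀ Z₀' : ι → ℕ}
    (h : ∀ Z, N Z = ⊥ ↔ Z₀ ≤ Z) (h' : ∀ Z, N Z = ⊥ ↔ Z₀' ≤ Z) : Z₀ = Z₀' :=
  le_antisymm ((h Z₀').mp ((h' Z₀').mpr le_rfl)) ((h' Z₀).mp ((h Z₀).mpr le_rfl))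

/-- The least vanishing cycle itself vanishes. [folklore] -/
theorem eq_bot_of_least {ι α : Type*} (N : (ι → ℕ) → α) [Bot α] {Z₀ : ι → ℕ}
    (h : ∀ Z, N Z = ⊥ ↔ Z₀ ≤ Z) : N Z₀ = ⊥ :=
  (h Z₀).mpr le_rfl

/-! ## (d) The annihilator is the X-complete ideal `I_{Z₀}` -/

section Annihilator

variable {ι T H : Type*} [CommRing T] [AddCommGroup H] [Module T H]

/-- `x` annihilates `H` iff multiplication by `x` on `H` has range `⊥`. [folklore] -/
theorem mem_annihilator_iff_range_lsmul_eq_bot (x : T) :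
    x ∈ Module.annihilator T H ↔ LinearMap.range (LinearMap.lsmul T H x) = ⊥ := by
  rw [Module.mem_annihilator, LinearMap.range_eq_bot]
  constructor
  · intro h
    ext m
    simpa using h m
  · intro h m
    simpa using LinearMap.congr_fun h m

/-- **LEMMA L (d): `ann_T H = I_{Z₀}`.** If `Z ↦ N Z ≤ H` is antitone and meet-subadditive on cycles
`ι → ℕ` (`ι` finite), vanishes somewhere, and (★) for every `x ≠ 0` the range of multiplication by
`x` on `H` is `N (Z_x)` for a «divisor map» `x ↦ Z_x = cyc x`, then there is a least vanishing cycle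
`Z₀`, and a non-zero `x` annihilates `H` iff `Z₀ ≤ Z_x` — i.e. `ann_T H` is the X-complete ideal
`I_{Z₀} = {0} ∪ {x : Z₀ ≤ Z_x}`. (CRUX-PLAN v4.0.2 §1.1 (d); (★) is its step (b).) [this work] -/
theorem mem_annihilator_iff_le_cyc [Finite ι] (N : (ι → ℕ) → Submodule T H) (anti : Antitone N)
    (hmeet : ∀ Z Z', N (Z ⊓ Z') ≤ N Z ⊔ N Z') (hvan : ∃ Z, N Z = ⊥) (cyc : T → ι → ℕ)
    (hstar : ∀ x : T, x ≠ 0 → LinearMap.range (LinearMap.lsmul T H x) = N (cyc x)) :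
    ∃ Z₀ : ι → ℕ, (∀ Z, N Z = ⊥ ↔ Z₀ ≤ Z) ∧
      ∀ x : T, x ∈ Module.annihilator T H ↔ x = 0 ∨ Z₀ ≤ cyc x := by
  obtain ⟨Z₀, hZ₀⟩ := exists_least_eq_bot N anti hmeet hvan
  refine ⟨Z₀, hZ₀, fun x => ?_⟩
  by_cases hx : x = 0
  · subst hx
    simp
  · rw [mem_annihilator_iff_range_lsmul_eq_bot, hstar x hx, hZ₀ (cyc x)]
    simp [hx]

/-- The same, with the least vanishing cycle `Z₀` given: an `x` satisfying (★) (available at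
`x ≠ 0`) annihilates `H` iff `Z₀ ≤ Z_x`. [this work] -/
theorem mem_annihilator_iff_le_cyc_of_least (N : (ι → ℕ) → Submodule T H) {Z₀ : ι → ℕ}
    (hZ₀ : ∀ Z, N Z = ⊥ ↔ Z₀ ≤ Z) (cyc : T → ι → ℕ) {x : T}
    (hstar : LinearMap.range (LinearMap.lsmul T H x) = N (cyc x)) :
    x ∈ Module.annihilator T H ↔ Z₀ ≤ cyc x := by
  rw [mem_annihilator_iff_range_lsmul_eq_bot, hstar, hZ₀ (cyc x)]

end Annihilator

/-! ## The hull step: intersections of X-complete ideals `I_Z = {0} ∪ {x : Z ≤ Z_x}` -/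

section Hull

variable {ι T : Type*} [Zero T] (cyc : T → ι → ℕ)

/-- `Z ↦ I_Z` is antitone: `Z ≤ Z'` gives `I_{Z'} ⊆ I_Z`. [folklore] -/
theorem setOf_cycleIdeal_antitone {Z Z' : ι → ℕ} (h : Z ≤ Z') :
    {x : T | x = 0 ∨ Z' ≤ cyc x} ⊆ {x : T | x = 0 ∨ Z ≤ cyc x} := by
  rintro x (hx | hx)
  · exact Or.inl hx
  · exact Or.inr (h.trans hx)

/-- **Finite hull:** `⋂_{j ∈ s} I_{Z_j} = I_{sup_{j ∈ s} Z_j}` for a finite family of cycles (the step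
«finitely many cycles `Z(L)` occur, so `ca(T) = ⋂_L I_{Z(L)} = I_Z`» of CRUX-PLAN v4.0.2 §1.3, before
taking the anti-nef hull of `Z`). [this work] -/
theorem iInter_setOf_le_cyc_eq_finsetSup {J : Type*} (s : Finset J) (Z : J → ι → ℕ) :
    (⋂ j ∈ s, {x : T | x = 0 ∨ Z j ≤ cyc x}) = {x : T | x = 0 ∨ s.sup Z ≤ cyc x} := by
  ext x
  simp only [Set.mem_iInter, Set.mem_setOf_eq, Finset.sup_le_iff]
  by_cases hx : x = 0
  · simp [hx]
  · simp [hx]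

/-- **Bounded hull:** for an arbitrary family of cycles bounded above (e.g. all `Z(L) ≤ c · Z_𝔪`
because every `I_{Z(L)}` contains `𝔪^c`), `⋂_j I_{Z_j} = I_{Z*}` with `Z*` the pointwise supremum.
[this work] -/
theorem iInter_setOf_le_cyc_eq_ciSup {J : Type*} [Nonempty J] (Z : J → ι → ℕ) (B : ι → ℕ)
    (hB : ∀ j, Z j ≤ B) :
    (⋂ j, {x : T | x = 0 ∨ Z j ≤ cyc x}) = {x : T | x = 0 ∨ (fun i => ⨆ j, Z j i) ≤ cyc x} := by
  have hbdd : ∀ i, BddAbove (Set.range fun j => Z j i) := fun i =>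
    ⟨B i, by rintro _ ⟨j, rfl⟩; exact hB j i⟩
  ext x
  simp only [Set.mem_iInter, Set.mem_setOf_eq]
  by_cases hx : x = 0
  · simp [hx]
  · simp only [hx, false_or]
    constructor
    · intro h i
      exact ciSup_le fun j => h j i
    · intro h j i
      exact (le_ciSup (hbdd i) j).trans (h i)

/-- Cycles below a fixed bound form a finite set («only finitely many `Z(L)` occur»). [folklore] -/
theorem finite_setOf_cycle_le [Finite ι] (B : ι → ℕ) : {Z : ι → ℕ | Z ≤ B}.Finite := by
  classical
  haveI : Fintype ι := Fintype.ofFinite ι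
  refine (Set.Finite.pi (t := fun i => {n : ℕ | n ≤ B i}) fun i => Set.finite_le_nat (B i)).subset ?_
  intro Z hZ
  exact Set.mem_univ_pi.mpr fun i => hZ i

end Hull

/-! ## Assembly of the lattice half: `⋂_L ann_T H_L = I_Z` for a bounded family -/

/-- **Hull of annihilators.** Given modules `H_L` (`L : Λ`, non-empty) each satisfying the hypotheses of
LEMMA L (d) with a common divisor map `x ↦ Z_x`, and a common bound `B` on the vanishing cycles
(`N_L B = ⊥` for all `L` — in the application `𝔪^c` kills every `H_L`), the intersection of the
annihilators is again an X-complete ideal: `⋂_L ann_T H_L = I_{Z*}`, `Z* = sup_L Z₀(L) ≤ B`. This is the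
lattice content of «`ca(T) = ⋂_L s̲ann(L) = ⋂_L I_{Z(L)} = I_Z`» (CRUX-PLAN v4.0.2 §1.3). [this work] -/
theorem exists_iInf_annihilator_eq {ι T Λ : Type*} [Finite ι] [CommRing T] [Nonempty Λ]
    (H : Λ → Type*) [∀ L, AddCommGroup (H L)] [∀ L, Module T (H L)]
    (N : ∀ L, (ι → ℕ) → Submodule T (H L)) (anti : ∀ L, Antitone (N L))
    (hmeet : ∀ L Z Z', N L (Z ⊓ Z') ≤ N L Z ⊔ N L Z') (B : ι → ℕ) (hB : ∀ L, N L B = ⊥)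
    (cyc : T → ι → ℕ)
    (hstar : ∀ L (x : T), x ≠ 0 → LinearMap.range (LinearMap.lsmul T (H L) x) = N L (cyc x)) :
    ∃ Zs : ι → ℕ, Zs ≤ B ∧
      ∀ x : T, (∀ L, x ∈ Module.annihilator T (H L)) ↔ x = 0 ∨ Zs ≤ cyc x := by
  have hL : ∀ L, ∃ Z₀ : ι → ℕ, (∀ Z, N L Z = ⊥ ↔ Z₀ ≤ Z) ∧
      ∀ x : T, x ∈ Module.annihilator T (H L) ↔ x = 0 ∨ Z₀ ≤ cyc x := fun L =>
    mem_annihilator_iff_le_cyc (N L) (anti L) (hmeet L) ⟨B, hB L⟩ cyc (hstar L)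
  choose Z₀ hZ₀ hann using hL
  have hZB : ∀ L, Z₀ L ≤ B := fun L => (hZ₀ L B).mp (hB L)
  have hbdd : ∀ i, BddAbove (Set.range fun L => Z₀ L i) := fun i =>
    ⟨B i, by rintro _ ⟨L, rfl⟩; exact hZB L i⟩
  refine ⟨fun i => ⨆ L, Z₀ L i, fun i => ciSup_le fun L => hZB L i, fun x => ?_⟩
  have key := Set.ext_iff.mp (iInter_setOf_le_cyc_eq_ciSup (T := T) cyc Z₀ B hZB) x
  simp only [Set.mem_iInter, Set.mem_setOf_eq] at key
  rw [← key]
  exact forall_congr' fun L => hann L x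

end Summit.ResolutionOfSingularities.ResolutionOfSingularities.Theorems.NoZeno.SandwichCluster.CycleLattice
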